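import Summits.QuantumFields.YangMills.Theorems.BalabanLadderNTClassicalShadowReflection
import Summits.QuantumFields.YangMills.Theorems.LangevinControlUVOSLegsFromFemtoAndGapStubLowerCube
import HarnessLib

/-!
# Crux `NT` (stmt-QuantumFields-19353), stub `stub_refpkgT : RefPkgT`: THE CLASSICAL SHADOW, VIII — the time-CENTRED cube is
# `Θ`-symmetric, so the orbit-test symmetry (S) holds for every `Θ`-invariant exterior of it

Helper file (`--supports stmt-QuantumFields-19353`) of the fleet lead prover of crux `NT` (unit `ym-spine-19353-p1`, GEN 14); sequel
of `…NTClassicalShadowReflection` (p604593).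

`kerE_cfgReflect_symm` asks that the time reflection map the interior edge set of the box onto itself.  For the tree's standard cubes —
radius `R` around a site, corner `x − R`, side `2R + 1` — centred on the time-zero hyperplane (`x 0 = 0`) this holds:

* `reflectEdge_mem_cubeEdges_centred` / `cubeEdges_centred_map_reflectEdge` — `θ(cubeEdges (x − R) (2R+1)) = cubeEdges (x − R) (2R+1)`
  whenever `x 0 = 0`;
* **`kerE_cfgReflect_symm_centred`** — for such a cube and every `Θ`-invariant exterior `η`, `kerE^η_β(F ∘ Θ) = kerE^η_β(F)`: hypothesis (S) of
  `…ClassicalShadowOrbit` for the time reflection, with no further side condition.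

HONEST FRAMING.  Finite bookkeeping; no floor, not AF, not NT, not the seam, not the gap; not Clay.
-/

set_option autoImplicit false

noncomputable section

open MeasureTheory Filter Topology
open Literature.MathematicalPhysics.QuantumFieldTheory Literature.MathematicalPhysics.QuantumLattice
open Literature.Probability.LatticeModels
open Summit.QuantumFields.YangMills.Cruxes.OSLegsFromFemtoAndGap.DlrCollarTransfer
open Summit.QuantumFields.YangMills.Cruxes.OSLegsFromFemtoAndGap.DlrCollarTransfer.StubLower (mem_cubeSites_iff)

namespace Summit.QuantumFields.YangMills.Cruxes.NT.ClassicalShadow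

/-! ## §1 The time-centred cube is reflection symmetric -/

section Centred

/-- Membership in `cubeEdges`: both endpoints are cube sites. [folklore] -/
theorem mem_cubeEdges_iff' (c : Fin 4 → ℤ) (b : ℕ) (e : Literature.MathematicalPhysics.QuantumLattice.ZdEdge 4) :
    e ∈ cubeEdges c b ↔ e.1 ∈ cubeSites c b ∧ e.1 + Pi.single e.2 1 ∈ cubeSites c b := by
  unfold cubeEdges
  simp only [Finset.mem_filter, Finset.mem_product, Finset.mem_univ, and_true]

/-- **The time reflection preserves the interior edges of a time-centred cube** (radius `R` around `x` with `x 0 = 0`). [folklore] -/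
theorem reflectEdge_mem_cubeEdges_centred {x : Fin 4 → ℤ} (hx : x 0 = 0) (R : ℕ)
    {e : Literature.MathematicalPhysics.QuantumLattice.ZdEdge 4} (he : e ∈ cubeEdges (fun j => x j - R) (2 * R + 1)) :
    reflectEdge e ∈ cubeEdges (fun j => x j - R) (2 * R + 1) := by
  obtain ⟨y, i⟩ := e
  rw [mem_cubeEdges_iff', mem_cubeSites_iff, mem_cubeSites_iff] at he ⊢
  obtain ⟨h1, h2⟩ := he
  by_cases hi : i = 0
  · subst hi
    simp only [reflectEdge, ↓reduceIte, sub_add_cancel]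
    refine ⟨fun j => ?_, fun j => ?_⟩
    · by_cases hj : j = 0
      · subst hj
        have a := h1 0; have b2 := h2 0
        simp only [Pi.add_apply, Pi.single_eq_same] at b2
        simp only [Pi.sub_apply, siteReflect_apply_zero, Pi.single_eq_same, hx]
        simp only [hx] at a b2
        push_cast at a b2 ⊢
        constructor <;> omega
      · have a := h1 j
        simp only [Pi.sub_apply, siteReflect_apply_of_ne _ hj, Pi.single_eq_of_ne hj, sub_zero]
        exact a
    · by_cases hj : j = 0
      · subst hj
        have a := h1 0
        simp only [siteReflect_apply_zero, hx]
        simp only [hx] at a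
        push_cast at a ⊢
        constructor <;> omega
      · have a := h1 j
        simp only [siteReflect_apply_of_ne _ hj]
        exact a
  · simp only [reflectEdge, hi, ↓reduceIte]
    refine ⟨fun j => ?_, fun j => ?_⟩
    · by_cases hj : j = 0
      · subst hj
        have a := h1 0
        simp only [siteReflect_apply_zero, hx]
        simp only [hx] at a
        push_cast at a ⊢
        constructor <;> omega
      · simp only [siteReflect_apply_of_ne _ hj]
        exact h1 j
    · rw [← siteReflect_add_single_of_ne _ hi]
      by_cases hj : j = 0
      · subst hj
        have a := h2 0
        simp only [siteReflect_apply_zero, hx, Pi.add_apply, Pi.single_eq_of_ne (Ne.symm hi) , add_zero]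
        simp only [hx, Pi.add_apply, Pi.single_eq_of_ne (Ne.symm hi), add_zero] at a
        push_cast at a ⊢
        constructor <;> omega
      · simp only [siteReflect_apply_of_ne _ hj]
        exact h2 j

/-- `θ(cubeEdges) = cubeEdges` for a time-centred cube. [folklore] -/
theorem cubeEdges_centred_map_reflectEdge {x : Fin 4 → ℤ} (hx : x 0 = 0) (R : ℕ) :
    (cubeEdges (fun j => x j - R) (2 * R + 1)).map reflectEdge_involutive.toPerm.toEmbedding =
      cubeEdges (fun j => x j - R) (2 * R + 1) := by
  ext e
  rw [Finset.mem_map_equiv, Function.Involutive.toPerm_symm, Function.Involutive.coe_toPerm]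
  constructor
  · intro h
    have h' := reflectEdge_mem_cubeEdges_centred hx R h
    rwa [reflectEdge_reflectEdge] at h'
  · exact reflectEdge_mem_cubeEdges_centred hx R

end Centred

/-! ## §2 Hypothesis (S) for the time reflection on a time-centred cube -/

section Symm

variable {G : Type} [Group G] [TopologicalSpace G] [IsTopologicalGroup G] [CompactSpace G]
  [MeasurableSpace G] [BorelSpace G] (r : LatticeRep G)

/-- **(S) for `Θ`**: on the cube of radius `R` around a site `x` of the time-zero hyperplane, every `Θ`-invariant exterior has a
`Θ`-invariant kernel: `kerE^η_β(F ∘ Θ) = kerE^η_β(F)` for measurable `F`. [folklore] -/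
theorem kerE_cfgReflect_symm_centred (β : ℝ) {x : Fin 4 → ℤ} (hx : x 0 = 0) (R : ℕ) {η : LGConfig 4 G} (hη : cfgReflect η = η)
    {F : LGConfig 4 G → ℝ} (hF : Measurable F) :
    kerE G r β (fun j => x j - R) (2 * R + 1) η (F ∘ cfgReflect) = kerE G r β (fun j => x j - R) (2 * R + 1) η F :=
  kerE_cfgReflect_symm r β (cubeEdges_centred_map_reflectEdge hx R) hη hF

end Symm

end Summit.QuantumFields.YangMills.Cruxes.NT.ClassicalShadow

end
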